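import Mathlib
import HarnessLib
import Literature.Analysis.FluidPDE.SelfSimilar
import Literature.Analysis.FluidPDE.LocalTypeI
import Literature.Analysis.FluidPDE.VectorCalculus
import Literature.Analysis.FluidPDE.ClassicalSolution
import Literature.Analysis.FluidPDE.TypeIAncientMild
import Literature.Analysis.UnboundedOperators.HeatKernel
import Summits.NavierStokesRegularity.NavierStokesRegularity.Theorems.LocalSineTubeDoorProfileAlignedWindowRigidityAncient
import Summits.NavierStokesRegularity.NavierStokesRegularity.Theorems.PoloidalWindowDoorPoloidalWindowRigidityWindow
import Summits.NavierStokesRegularity.NavierStokesRegularity.Theorems.PoloidalWindowDoorPoloidalWindowRigidityFlat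
import Summits.NavierStokesRegularity.NavierStokesRegularity.Theorems.PoloidalWindowDoorPoloidalWindowRigidityClassRate
import Summits.NavierStokesRegularity.NavierStokesRegularity.Theorems.PoloidalWindowDoorPoloidalWindowRigidityScrewAssembly
import Summits.NavierStokesRegularity.NavierStokesRegularity.Theorems.PoloidalWindowDoorPoloidalWindowRigidityDecayingSlopeLiouville

/-!
# Route `PoloidalWindowDoor`, crux `PoloidalWindowRigidity` (K2, stmt-NavierStokesRegularity-19708) — the stratum
# «SPATIALLY CONSTANT PRESSURE GRADIENT» (affine pressure) is empty, WITHOUT poloidality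

Cell ns-regularity-ideate, seat ns-poloidal-K2-p3 (stub-worker; support theorem `--supports` the crux, `--as helper`).
Companion of `…VerticalSourceGauge` (this seat): there the `e₃`-component of the material operator
`∂ₜv + (v·∇)v − Δv` (`= −∇p` on every window) was assumed spatially constant and poloidality finished the proof
through the flat stratum.  If ALL THREE components are spatially constant on every slice — the pressure is affine in
`x`, `∇p = ∇p(t)` — no poloidality is needed at all: every Cartesian component `θᵢ = ⟪v, eᵢ⟫` of a profile of the
route's Type-I class is jointly `C²`, transported–diffused with a time-only source, and has decaying slope `C₁/(−t)`
(gradient rate of nsreg-p7's `…ClassRate`), so the K2 lead's ancient decaying-slope Liouville lemma L4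
(`…DecayingSlopeLiouville.stub_decayingSlopeLiouville`, p457547) makes every slice spatially constant, and the Oseen
gauge excludes slice-constant profiles (tree `IsTypeIAncientMild.eq_zero_of_slice_const`, KNSS 2009 Remark 6.1).
In words: **in the KNSS-gauge Type-I ancient class the pressure gradient is load-bearing — a profile with affine
pressure is trivial** (`eq_zero_of_constantPressureGradient`).

WHAT THIS IS NOT: not a claim about Navier–Stokes regularity and not the open residue — one more settled stratum
(no poloidality) of a door route's Type-I Liouville problem (bears_on LADDER-NS N0, rung N0-LocalTubeDoorPoloidal).
-/

noncomputable section

-- the summit and its single sub-problem share the name (CONVENTIONS §1), as in every Theorems file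
set_option linter.dupNamespace false

namespace Summit.NavierStokesRegularity.NavierStokesRegularity.Theorems.PoloidalWindowDoorPoloidalWindowRigidityConstantPressureGradient

open MeasureTheory Set Function Filter Topology TopologicalSpace Metric InnerProductSpace
open scoped RealInnerProductSpace InnerProductSpace Laplacian ContDiff
open Literature.Analysis Literature.Analysis.FluidPDE
open Summit.NavierStokesRegularity.NavierStokesRegularity.Theorems.LocalSineTubeDoorProfileAlignedWindowRigidityAncient
open Summit.NavierStokesRegularity.NavierStokesRegularity.Theorems.PoloidalWindowDoorPoloidalWindowRigidityWindow
open Summit.NavierStokesRegularity.NavierStokesRegularity.Theorems.PoloidalWindowDoorPoloidalWindowRigidityFlat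
open Summit.NavierStokesRegularity.NavierStokesRegularity.Theorems.PoloidalWindowDoorPoloidalWindowRigidityClassRate
open Summit.NavierStokesRegularity.NavierStokesRegularity.Theorems.PoloidalWindowDoorPoloidalWindowRigidityScrewAssembly
open Summit.NavierStokesRegularity.NavierStokesRegularity.Theorems.PoloidalWindowDoorPoloidalWindowRigidityDecayingSlopeLiouville

variable {C : ℝ} {v : ℝ → EuclideanSpace ℝ (Fin 3) → EuclideanSpace ℝ (Fin 3)}

/-! ### The Cartesian components `θ = ⟪v, e⟫` of a profile of the class -/

/-- **`θ(t,y) = ⟪v(t,y), e⟫` is jointly `C²` on the open slab** for every fixed vector `e`. -/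
theorem contDiffOn_component (hrate : HasTypeITimeDecay C v)
    (hcont : ContinuousOn (uncurry v) (Iio (0 : ℝ) ×ˢ univ))
    (hmild : ∀ s t : ℝ, s < t → t < 0 → ∀ x,
      v t x = UnboundedOperators.heatExtension (v s) (t - s) x - oseenDuhamel 1 s v v t x)
    (hdiv : ∀ t < 0, VectorCalculus.IsDivFree (v t)) (e : EuclideanSpace ℝ (Fin 3)) :
    ContDiffOn ℝ 2 (uncurry fun (t : ℝ) (y : EuclideanSpace ℝ (Fin 3)) => ⟪v t y, e⟫_ℝ) (Iio (0 : ℝ) ×ˢ univ) := by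
  have hA : IsTypeIAncientMild C v := isTypeIAncientMild_of_class hrate hcont hmild hdiv
  have h1 : ContDiffOn ℝ 2 (uncurry v) (Iio (0 : ℝ) ×ˢ univ) := contDiffOn_infty.1 hA.contDiffOn 2
  exact h1.inner ℝ contDiffOn_const

/-- **The transported–diffused equation of `θ = ⟪v, e⟫`**: for `t < 0`, `x`,
`∂ₜθ + (v·∇)θ − Δθ = ⟪∂ₜv + (v·∇)v − Δv, e⟫(t,x)` (the `e`-component of the material operator; `= −⟪∇p, e⟫` on
every window with a classical pressure). -/
theorem component_equation (hrate : HasTypeITimeDecay C v)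
    (hcont : ContinuousOn (uncurry v) (Iio (0 : ℝ) ×ˢ univ))
    (hmild : ∀ s t : ℝ, s < t → t < 0 → ∀ x,
      v t x = UnboundedOperators.heatExtension (v s) (t - s) x - oseenDuhamel 1 s v v t x)
    (hdiv : ∀ t < 0, VectorCalculus.IsDivFree (v t)) (e : EuclideanSpace ℝ (Fin 3)) {t : ℝ} (ht : t < 0)
    (x : EuclideanSpace ℝ (Fin 3)) :
    deriv (fun τ => ⟪v τ x, e⟫_ℝ) t + fderiv ℝ (fun y => ⟪v t y, e⟫_ℝ) x (v t x) - (Δ (fun y => ⟪v t y, e⟫_ℝ)) x =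
      ⟪timeDerivWithin (Iio 0) v t x + convect (v t) (v t) x - (Δ (v t)) x, e⟫_ℝ := by
  have hA : IsTypeIAncientMild C v := isTypeIAncientMild_of_class hrate hcont hmild hdiv
  have hsm : IsSmoothSpaceTimeOn (Iio (0 : ℝ)) v := hA.contDiffOn
  have hv2 : ContDiff ℝ 2 (v t) := contDiff_infty.1 (hA.contDiff_slice ht) 2
  have hvd : DifferentiableAt ℝ (v t) x := (hv2.differentiable two_ne_zero) x
  -- (T) the time derivative: `Iio 0` is open
  have hT : deriv (fun τ => ⟪v τ x, e⟫_ℝ) t = ⟪timeDerivWithin (Iio 0) v t x, e⟫_ℝ := by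
    have hd : HasDerivWithinAt (fun τ => v τ x) (timeDerivWithin (Iio 0) v t x) (Iio 0) t := by
      rw [timeDerivWithin_apply]
      exact (hsm.differentiableWithinAt_time ht x).hasDerivWithinAt
    have hd' : HasDerivAt (fun τ => v τ x) (timeDerivWithin (Iio 0) v t x) t :=
      hd.hasDerivAt (Iio_mem_nhds ht)
    have h1 := hd'.inner ℝ (hasDerivAt_const t e)
    simp only [inner_zero_right, zero_add] at h1
    exact h1.deriv
  -- (X) the convective derivative
  have hX : fderiv ℝ (fun y => ⟪v t y, e⟫_ℝ) x (v t x) = ⟪convect (v t) (v t) x, e⟫_ℝ := by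
    rw [fderiv_inner_apply ℝ hvd (differentiableAt_const e) (v t x), fderiv_fun_const]
    simp [convect]
  -- (L) the Laplacian
  have hL : (Δ (fun y => ⟪v t y, e⟫_ℝ)) x = ⟪(Δ (v t)) x, e⟫_ℝ := by
    have hfun : (fun y => ⟪v t y, e⟫_ℝ) = (innerSL ℝ e : EuclideanSpace ℝ (Fin 3) →L[ℝ] ℝ) ∘ v t := by
      funext y; simp only [Function.comp_apply, innerSL_apply_apply, real_inner_comm]
    rw [hfun, hv2.contDiffAt.laplacian_CLM_comp_left, Function.comp_apply, innerSL_apply_apply, real_inner_comm]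
  rw [hT, hX, hL, inner_sub_left, inner_add_left]

/-- **Decaying slope of `θ = ⟪v, eᵢ⟫`** (coordinate directions): `|θ(t,x) − θ(t,0)| ≤ (C₁/(−t))‖x − 0‖` with the
gradient rate `C₁` of the class (nsreg-p7 `exists_fderiv_rate_of_class`, mean value inequality, `‖eᵢ‖ = 1`). -/
theorem component_slope (hrate : HasTypeITimeDecay C v)
    (hcont : ContinuousOn (uncurry v) (Iio (0 : ℝ) ×ˢ univ))
    (hmild : ∀ s t : ℝ, s < t → t < 0 → ∀ x,
      v t x = UnboundedOperators.heatExtension (v s) (t - s) x - oseenDuhamel 1 s v v t x)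
    {C₁ : ℝ} (hC₁ : ∀ t < 0, ∀ y, ‖fderiv ℝ (v t) y‖ ≤ C₁ / (-t)) (i : Fin 3) {t : ℝ} (ht : t < 0)
    (x : EuclideanSpace ℝ (Fin 3)) :
    |⟪v t x, (EuclideanSpace.single i (1 : ℝ) : EuclideanSpace ℝ (Fin 3))⟫_ℝ
        - ⟪v t 0, (EuclideanSpace.single i (1 : ℝ) : EuclideanSpace ℝ (Fin 3))⟫_ℝ| ≤ C₁ / (-t) * ‖x - 0‖ := by
  have hbdd := bdd_of_hasTypeITimeDecay hrate
  have hC1 : ContDiff ℝ 1 (v t) := (analyticOnNhd_slice hcont hbdd hmild ht).contDiff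
  have hd : Differentiable ℝ (v t) := hC1.differentiable one_ne_zero
  have hmv : ‖v t x - v t 0‖ ≤ C₁ / (-t) * ‖x - 0‖ :=
    (convex_univ).norm_image_sub_le_of_norm_fderiv_le (fun y _ => hd y) (fun y _ => hC₁ t ht y)
      (mem_univ 0) (mem_univ x)
  have he : ‖(EuclideanSpace.single i (1 : ℝ) : EuclideanSpace ℝ (Fin 3))‖ = 1 := by
    rw [EuclideanSpace.single, PiLp.norm_single, norm_one]
  rw [← inner_sub_left]
  calc |⟪v t x - v t 0, (EuclideanSpace.single i (1 : ℝ) : EuclideanSpace ℝ (Fin 3))⟫_ℝ|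
      ≤ ‖v t x - v t 0‖ * ‖(EuclideanSpace.single i (1 : ℝ) : EuclideanSpace ℝ (Fin 3))‖ :=
        abs_real_inner_le_norm _ _
    _ = ‖v t x - v t 0‖ := by rw [he, mul_one]
    _ ≤ C₁ / (-t) * ‖x - 0‖ := hmv

/-! ### The stratum -/

/-- **Spatially constant pressure gradient ⇒ trivial (no poloidality).**  A profile of the route's Type-I class for
which `∂ₜv + (v·∇)v − Δv` (`= −∇p` on every window) is SPATIALLY CONSTANT on every slice vanishes identically: each
Cartesian component `⟪v, eᵢ⟫` is constant on every slice by the lead's L4 `stub_decayingSlopeLiouville`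
(`contDiffOn_component`, `component_equation`, `component_slope`, rate lemmas of `…ScrewAssembly`), so every slice is
spatially constant and the Oseen gauge kills it (`IsTypeIAncientMild.eq_zero_of_slice_const`). -/
theorem eq_zero_of_constantPressureGradient (hrate : HasTypeITimeDecay C v)
    (hcont : ContinuousOn (uncurry v) (Iio (0 : ℝ) ×ˢ univ))
    (hmild : ∀ s t : ℝ, s < t → t < 0 → ∀ x,
      v t x = UnboundedOperators.heatExtension (v s) (t - s) x - oseenDuhamel 1 s v v t x)
    (hdiv : ∀ t < 0, VectorCalculus.IsDivFree (v t))
    (hsrc : ∀ t < 0, ∀ x,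
      timeDerivWithin (Iio 0) v t x + convect (v t) (v t) x - (Δ (v t)) x =
        timeDerivWithin (Iio 0) v t 0 + convect (v t) (v t) 0 - (Δ (v t)) 0) :
    ∀ t < 0, ∀ x, v t x = 0 := by
  obtain ⟨C₁, hC₁⟩ := exists_fderiv_rate_of_class hrate hcont hmild
  have hA : IsTypeIAncientMild C v := isTypeIAncientMild_of_class hrate hcont hmild hdiv
  -- ## every Cartesian component is constant on every slice (L4)
  have hcomp : ∀ i : Fin 3, ∀ t < 0, ∀ x,
      ⟪v t x, (EuclideanSpace.single i (1 : ℝ) : EuclideanSpace ℝ (Fin 3))⟫_ℝ =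
        ⟪v t 0, (EuclideanSpace.single i (1 : ℝ) : EuclideanSpace ℝ (Fin 3))⟫_ℝ := fun i =>
    stub_decayingSlopeLiouville C v hrate hcont hmild hdiv
      (fun t y => ⟪v t y, (EuclideanSpace.single i (1 : ℝ) : EuclideanSpace ℝ (Fin 3))⟫_ℝ)
      (fun t => ⟪timeDerivWithin (Iio 0) v t 0 + convect (v t) (v t) 0 - (Δ (v t)) 0,
        (EuclideanSpace.single i (1 : ℝ) : EuclideanSpace ℝ (Fin 3))⟫_ℝ)
      0 (fun t => C₁ / (-t))
      (contDiffOn_component hrate hcont hmild hdiv _)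
      (fun t ht x => by rw [component_equation hrate hcont hmild hdiv _ ht x, hsrc t ht x])
      (fun t ht x => component_slope hrate hcont hmild hC₁ i ht x)
      (continuousOn_rate C₁) (tendsto_rate_mul_sqrt C₁)
  -- ## hence every slice is spatially constant, and the gauge kills it
  have hconst : ∀ t < 0, ∀ x, v t x = v t 0 := by
    intro t ht x
    ext i
    have h := hcomp i t ht x
    simpa [EuclideanSpace.inner_single_right] using h
  exact fun t ht x => hA.eq_zero_of_slice_const (b := fun t => v t 0) hconst ht x

/-- **Spatially constant pressure gradient ⇒ not backward-singular.** -/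
theorem nonflatLiouville_of_constantPressureGradient (hrate : HasTypeITimeDecay C v)
    (hcont : ContinuousOn (uncurry v) (Iio (0 : ℝ) ×ˢ univ))
    (hmild : ∀ s t : ℝ, s < t → t < 0 → ∀ x,
      v t x = UnboundedOperators.heatExtension (v s) (t - s) x - oseenDuhamel 1 s v v t x)
    (hdiv : ∀ t < 0, VectorCalculus.IsDivFree (v t))
    (hsrc : ∀ t < 0, ∀ x,
      timeDerivWithin (Iio 0) v t x + convect (v t) (v t) x - (Δ (v t)) x =
        timeDerivWithin (Iio 0) v t 0 + convect (v t) (v t) 0 - (Δ (v t)) 0) :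
    ¬ IsBackwardSingularPoint v 0 :=
  not_backwardSingular_of_zero (eq_zero_of_constantPressureGradient hrate hcont hmild hdiv hsrc)

end Summit.NavierStokesRegularity.NavierStokesRegularity.Theorems.PoloidalWindowDoorPoloidalWindowRigidityConstantPressureGradient

end
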